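import Summits.Ventures.CertifiedManyBodySolver.Observables.StiffnessHalfBathtubParticleHole
import HarnessLib

/-!
# Ventures/CertifiedManyBodySolver — Observables/ThermalFluxZeeman.lean

HONEST FRAMING: one-sided kinematic (one-body) CEILINGS on the THERMAL uniform flux stiffness of the strictly two-dimensional one-band
`t–t′` Hubbard torus IN A UNIFORM ZEEMAN FIELD `h` (canonical particle number, ALL `S^z` sectors weighted by `e^{βh S^z}`), at every
temperature and every `h`, on FINITE tori and in the thermodynamic-limit form with an explicit rate; a ceiling never speaks to the presence
of order; not a `T_c` estimate, not a superconductivity verdict. The ORBITAL coupling of a field (Peierls phases) is NOT treated here.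

Cell `hubbard-tc` (MO-S3 ORDER → `T_c` back-end, D-0096; output continuum `T × P × H`, D-0099/D-0100), seat p1, `prover-hubbard-tc-p1-g5-0`.
The cell's ASSUMPTIONS §2 AXES (hubbard-tc-mod-2) prints the kinematic `T_c` ceilings «valid for every Zeeman field» on an elementary,
untyped argument; this file and its companion `StiffnessThermalLeafZeeman` make the ZEEMAN half a kernel theorem. Here (all nodes closed,
standard axioms; pub-hubbard's finite-torus chain re-used sector by sector):

* §1 `zeemanFluxZ L tp U δ β h θ = Σ_{M=0}^{N_L} e^{βh(M − N_L/2)} Re Z_β(H^{tt′}(θ)|_{(N_L, M)})` — the canonical `N_L = 2⌊(1−δ)L²/2⌋`-electron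
  partition function of the flux-twisted torus `hubbardTorusTT'Flux L tp U θ` with the Zeeman weight `e^{βh S^z}`, `S^z = M − N_L/2` on the
  coordinate sector with `M` spin-`0` («up») orbitals (the field term `−h S^z` commutes with `H(θ)` and is diagonal in the occupation
  basis, so `Tr_{N_L} e^{−β(H(θ) − h S^z)}` IS this sector sum; the operator identity itself is not re-derived here — the sector sum is
  the definition); `thermalFluxLogZZeeman = log zeemanFluxZ`; the lattice rotation respects every `(N, S^z)` sector
  (`spinSector_iff_of_fockMapOp_rot_ne_zero`);
* §2 per sector, pub-hubbard's flux-cost bound `log Z_p(0) − β(1 − cos(θ/L))·Re⟨kinOpTT'⟩_{β,p} ≤ log Z_p(θ)`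
  (`log_partitionFn_toBlock_hubbardTorusTT'Flux_ge`, Paramekanti–Trivedi–Randeria at `T > 0`) and the rotation-compatible-sector kinetic
  ceiling `½Re⟨kinOpTT'⟩_{β,p} ≤ νN/2 + Σ_k(cos k₁ + cos k₂ + 4t′cos k₁cos k₂ − ν)⁺` (`re_gibbsState_kinOpTT'_toBlock_le`, valid on EVERY
  `(N, S^z = M)` sector — the rotation does not touch spins) give `Z_p(θ) ≥ e^{−D}Z_p(0)` with ONE exponent
  `D = β(1 − cos(θ/L))·(νN_L + 2Σ_k(…)⁺)` for all `M` (`re_partitionFn_flux_ge_of_sector`); summing with the positive Zeeman weights,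
  `log Z_h(0) − log Z_h(θ) ≤ D` (`thermalFluxLogZZeeman_sub_le`) — uniformly in `h`;
* §3 hence a thermal flux stiffness of the field-`h` ensemble, `βρ_sθ² ≤ log Z_h(0) − log Z_h(θ)` on `|θ| ≤ θ₀`, obeys
  `ρ_s L² ≤ νN_L/2 + Σ_k(…)⁺` (`zeemanStiffness_mul_sq_le`; the right-hand side of `ThermalHalfBathtubStiffnessBoundTT'`, the `S^z = 0`
  ensemble) and, with pub-hubbard's explicit rate, `ρ_s ≤ ν·(1−δ)/2 + B(t′, ν) + (|ν| + 2π(1 + 4|t′|))/L` (`zeemanStiffness_le_halfBathtub`),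
  `B = (4π²)⁻¹∫∫(…)⁺`.

What this does NOT say: nothing about the orbital effect of a field, nothing about vortices or `H_{c2}`; at `h = 0` the ensemble is the
full `N_L`-electron space (all `S^z`), not the `(N_L, S^z = 0)` sector of `thermalFluxLogZ`.

References: A. Paramekanti, N. Trivedi, M. Randeria, PRB 57 (1998) 11639, eq. (3), §IV [ParamekantiTrivediRanderia1998]; T. Hazra,
N. Verma, M. Randeria, PRX 9 (2019) 031049, eqs. (2)–(6) [HazraVermaRanderia2019]; D. J. Scalapino, S. R. White, S. Zhang,
PRB 47 (1993) 7995, §II [ScalapinoWhiteZhang1993].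
-/

noncomputable section


namespace Summit.Ventures.CertifiedManyBodySolver.Observables

open Filter Topology Set Real MeasureTheory Matrix
open Literature.MathematicalPhysics.QuantumLattice
open Literature.MathematicalPhysics.QuantumFieldTheory
open Literature.Probability.LatticeModels
open Literature.MathematicalPhysics.StatisticalMechanics
open Literature.MathematicalPhysics.StatisticalMechanics.KosterlitzThouless
open Summit.HubbardSuperconductivity.HubbardLadder.Bounds
open scoped ComplexConjugate ComplexOrder

variable {L : ℕ}

/-! ## §1 Spin sectors and the Zeeman-weighted canonical flux partition function -/

/-- **The lattice rotation `Γ(r)` does not connect an `(N, S^z)` coordinate sector to its complement**: a non-zero entry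
`Γ(r)_{s,t}` forces `s = r·t`, and `r·t` has as many orbitals and as many spin-`0` orbitals as `t` (spins are not touched).
[cite: ScalapinoWhiteZhang1993, §II] -/
theorem spinSector_iff_of_fockMapOp_rot_ne_zero [NeZero L] (N M : ℕ) {s t : Finset (Orb (FermionTorus 2 L))}
    (h : fockMapOp (d4Orb (DihedralGroup.r 1 : DihedralGroup 4)) s t ≠ 0) :
    (s.card = N ∧ (s.filter fun i => (ofLex i).2 = 0).card = M) ↔
      (t.card = N ∧ (t.filter fun i => (ofLex i).2 = 0).card = M) := by
  rw [d4Orb_eq_coe_mapEquiv, fockMapOp_equiv] at h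
  have hst : s = (Orb.mapEquiv (FermionTorus.ofTorusEquiv
      (d4SiteEquiv (L := L) (DihedralGroup.r 1 : DihedralGroup 4)))).finsetCongr t := by
    by_contra hne
    apply h
    unfold relabelMatrix
    exact if_neg hne
  subst hst
  rw [card_filter_spin_zero_finsetCongr, Equiv.finsetCongr_apply, Finset.card_map]

/-- The `(2n, S^z = 0)` sector in the `(N, M)` form is non-empty for `n ≤ L²` (take `α↑ ∪ α↓`). [cite: ScalapinoWhiteZhang1993, §II] -/
theorem nonempty_spinSector_half {n : ℕ} (hn : n ≤ L ^ 2) :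
    Nonempty {s : Finset (Orb (FermionTorus 2 L)) //
      s.card = 2 * n ∧ (s.filter fun i => (ofLex i).2 = 0).card = n} := by
  obtain ⟨⟨s, hs1, hs2⟩⟩ := nonempty_spinZeroSector (L := L) hn
  exact ⟨⟨s, hs1, by omega⟩⟩

/-- **The Zeeman-weighted canonical flux partition function**
`Z_h(θ) = Σ_{M=0}^{N_L} e^{βh(M − N_L/2)} Re Z_β(H^{tt′}(θ)|_{(N_L, M)})`, `N_L = 2⌊(1−δ)L²/2⌋`, `H(θ) = hubbardTorusTT'Flux L tp U θ`,
`(N_L, M)` the coordinate sector of `N_L`-electron occupation sets with `M` spin-`0` orbitals (`S^z = M − N_L/2`): the trace of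
`e^{−β(H(θ) − h S^z)}` over the `N_L`-electron space, written sector by sector (`S^z` commutes with `H(θ)` and is diagonal in the
occupation basis). At `h = 0` it is the full `N_L`-electron partition function. [cite: ScalapinoWhiteZhang1993, §II] -/
def zeemanFluxZ (L : ℕ) [NeZero L] (tp U δ β h θ : ℝ) : ℝ :=
  ∑ M ∈ Finset.range (2 * ⌊(1 - δ) * (L : ℝ) ^ 2 / 2⌋₊ + 1),
    Real.exp (β * h * ((M : ℝ) - ⌊(1 - δ) * (L : ℝ) ^ 2 / 2⌋₊)) *
      (partitionFn β ((hubbardTorusTT'Flux L tp U θ).toBlock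
        (fun s : Finset (Orb (FermionTorus 2 L)) =>
          s.card = 2 * ⌊(1 - δ) * (L : ℝ) ^ 2 / 2⌋₊ ∧ (s.filter fun i => (ofLex i).2 = 0).card = M)
        (fun s : Finset (Orb (FermionTorus 2 L)) =>
          s.card = 2 * ⌊(1 - δ) * (L : ℝ) ^ 2 / 2⌋₊ ∧ (s.filter fun i => (ofLex i).2 = 0).card = M))).re

/-- **`log Z_h(θ)`** of the Zeeman-weighted canonical ensemble; `−β⁻¹·log Z_h` is the field-`h` canonical free energy `F_h(θ)` whose
curvature in `θ` is the thermal superfluid stiffness at `T = 1/β` in the field. [cite: ScalapinoWhiteZhang1993, §II] -/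
def thermalFluxLogZZeeman (L : ℕ) [NeZero L] (tp U δ β h θ : ℝ) : ℝ :=
  Real.log (zeemanFluxZ L tp U δ β h θ)

/-! ## §2 The flux costs at most the kinetic ceiling — uniformly over the spin sectors -/

/-- `Z = 0` on an empty index type (the trace of a `0 × 0` matrix). [cite: ScalapinoWhiteZhang1993, §II] -/
theorem partitionFn_of_isEmpty {m : Type*} [Fintype m] [DecidableEq m] [IsEmpty m] (β : ℝ) (A : Matrix m m ℂ) :
    partitionFn β A = 0 := by
  simp [partitionFn, Matrix.trace]

/-- **Per-sector flux cost ≤ the kinetic ceiling, with a sector-independent exponent.** On every coordinate sector `p` of `N`-electron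
sets respected by the rotation `Γ(r)` (e.g. every `(N, S^z = M)` sector), for `β ≥ 0`, every `θ` and every `ν`:
`e^{−β(1 − cos(θ/L))(νN + 2Σ_k(…)⁺)} · Re Z_p(0) ≤ Re Z_p(θ)` (both sides vanish on an empty sector).
[cite: ParamekantiTrivediRanderia1998, eq. (3) and §IV] -/
theorem re_partitionFn_flux_ge_of_sector [NeZero L] (hL : 3 ≤ L) (tp U θ ν : ℝ) {β : ℝ} (hβ : 0 ≤ β) (N : ℕ)
    (p : Finset (Orb (FermionTorus 2 L)) → Prop) [DecidablePred p] (hpN : ∀ s, p s → s.card = N)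
    (hpΓ : ∀ s t, fockMapOp (d4Orb (DihedralGroup.r 1 : DihedralGroup 4)) s t ≠ 0 → (p s ↔ p t)) :
    Real.exp (-(β * (1 - Real.cos (θ / L)) * (ν * (N : ℝ) + 2 * ∑ k : TorusSite 2 L, ttBathtub tp ν k))) *
        (partitionFn β ((hubbardTorusTT'Flux L tp U 0).toBlock p p)).re ≤
      (partitionFn β ((hubbardTorusTT'Flux L tp U θ).toBlock p p)).re := by
  rcases isEmpty_or_nonempty {a // p a} with hp | hp
  · rw [partitionFn_of_isEmpty, partitionFn_of_isEmpty, Complex.zero_re, mul_zero]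
  -- the flux-cost bound and the kinetic ceiling on the sector
  have hA := log_partitionFn_toBlock_hubbardTorusTT'Flux_ge hL tp U θ β p
  have hK := re_gibbsState_kinOpTT'_toBlock_le hL tp U β ν N p hpN hpΓ
  set K := (gibbsState β ((hubbardTorusTT' L 1 tp U).toBlock p p) ((kinOpTT' L tp).toBlock p p)).re with hKdef
  have h0 : 0 < (partitionFn β ((hubbardTorusTT'Flux L tp U 0).toBlock p p)).re := by
    rw [hubbardTorusTT'Flux_zero]
    exact partitionFn_re_pos ((hubbardTorusTT'_isHermitian L 1 tp U).submatrix _) β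
  have hθ : 0 < (partitionFn β ((hubbardTorusTT'Flux L tp U θ).toBlock p p)).re :=
    partitionFn_re_pos ((isHermitian_hubbardTorusTT'Flux L tp U θ).submatrix _) β
  have hc : 0 ≤ β * (1 - Real.cos (θ / L)) := mul_nonneg hβ (sub_nonneg.2 (Real.cos_le_one _))
  have hKle : β * (1 - Real.cos (θ / L)) * K ≤
      β * (1 - Real.cos (θ / L)) * (ν * (N : ℝ) + 2 * ∑ k : TorusSite 2 L, ttBathtub tp ν k) :=
    mul_le_mul_of_nonneg_left (by linarith) hc
  have hlog : Real.log (partitionFn β ((hubbardTorusTT'Flux L tp U 0).toBlock p p)).re -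
      β * (1 - Real.cos (θ / L)) * (ν * (N : ℝ) + 2 * ∑ k : TorusSite 2 L, ttBathtub tp ν k) ≤
      Real.log (partitionFn β ((hubbardTorusTT'Flux L tp U θ).toBlock p p)).re := by
    rw [hubbardTorusTT'Flux_zero] at h0 ⊢
    linarith
  have hexp := Real.exp_le_exp.2 hlog
  rwa [Real.exp_sub, Real.exp_log h0, Real.exp_log hθ, div_eq_mul_inv, ← Real.exp_neg, mul_comm] at hexp

/-- `Z_h(0) > 0` for `δ ≥ −1` (the `S^z = 0` sector is non-empty and every term is `≥ 0`). [cite: ScalapinoWhiteZhang1993, §II] -/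
theorem zeemanFluxZ_pos [NeZero L] (tp U β h θ : ℝ) {δ : ℝ} (hδ : -1 ≤ δ) :
    0 < zeemanFluxZ L tp U δ β h θ := by
  unfold zeemanFluxZ
  set n := ⌊(1 - δ) * (L : ℝ) ^ 2 / 2⌋₊ with hn
  have hterm : ∀ M ∈ Finset.range (2 * n + 1), 0 ≤ Real.exp (β * h * ((M : ℝ) - n)) *
      (partitionFn β ((hubbardTorusTT'Flux L tp U θ).toBlock
        (fun s : Finset (Orb (FermionTorus 2 L)) => s.card = 2 * n ∧ (s.filter fun i => (ofLex i).2 = 0).card = M)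
        (fun s : Finset (Orb (FermionTorus 2 L)) => s.card = 2 * n ∧ (s.filter fun i => (ofLex i).2 = 0).card = M))).re := by
    intro M _
    refine mul_nonneg (Real.exp_nonneg _) ?_
    rcases isEmpty_or_nonempty {a // (fun s : Finset (Orb (FermionTorus 2 L)) =>
        s.card = 2 * n ∧ (s.filter fun i => (ofLex i).2 = 0).card = M) a} with hp | hp
    · rw [partitionFn_of_isEmpty, Complex.zero_re]
    · exact (partitionFn_re_pos ((isHermitian_hubbardTorusTT'Flux L tp U θ).submatrix _) β).le
  have hmem : n ∈ Finset.range (2 * n + 1) := Finset.mem_range.2 (by omega)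
  refine lt_of_lt_of_le ?_ (Finset.single_le_sum hterm hmem)
  haveI := nonempty_spinSector_half (L := L) (Summit.HubbardSuperconductivity.NoGo.floor_pairNumber_le δ hδ L)
  exact mul_pos (Real.exp_pos _) (partitionFn_re_pos ((isHermitian_hubbardTorusTT'Flux L tp U θ).submatrix _) β)

/-- **The Zeeman ensemble's flux cost ≤ the kinetic ceiling**: for `L ≥ 3`, `δ ≥ −1`, `β ≥ 0`, every `h`, `θ`, `ν`:
`e^{−β(1 − cos(θ/L))(νN_L + 2Σ_k(…)⁺)} · Z_h(0) ≤ Z_h(θ)` (sum of the per-sector bounds with the positive Zeeman weights).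
[cite: ParamekantiTrivediRanderia1998, eq. (3) and §IV] -/
theorem zeemanFluxZ_ge [NeZero L] (hL : 3 ≤ L) (tp U h θ ν : ℝ) {β δ : ℝ} (hβ : 0 ≤ β) :
    Real.exp (-(β * (1 - Real.cos (θ / L)) *
        (ν * ((2 * ⌊(1 - δ) * (L : ℝ) ^ 2 / 2⌋₊ : ℕ) : ℝ) + 2 * ∑ k : TorusSite 2 L, ttBathtub tp ν k))) *
        zeemanFluxZ L tp U δ β h 0 ≤
      zeemanFluxZ L tp U δ β h θ := by
  unfold zeemanFluxZ
  rw [Finset.mul_sum]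
  refine Finset.sum_le_sum fun M _ => ?_
  rw [mul_left_comm]
  refine mul_le_mul_of_nonneg_left ?_ (Real.exp_nonneg _)
  exact re_partitionFn_flux_ge_of_sector hL tp U θ ν hβ _ _ (fun s hs => hs.1)
    (fun s t hst => spinSector_iff_of_fockMapOp_rot_ne_zero _ _ hst)

/-- **`log Z_h(0) − log Z_h(θ) ≤ β(1 − cos(θ/L))·(νN_L + 2Σ_k(…)⁺)`** for every `ν`, every field `h` (`L ≥ 3`, `δ ≥ −1`, `β ≥ 0`).
[cite: ParamekantiTrivediRanderia1998, eq. (3) and §IV] -/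
theorem thermalFluxLogZZeeman_sub_le [NeZero L] (hL : 3 ≤ L) (tp U h θ ν : ℝ) {β δ : ℝ} (hβ : 0 ≤ β) (hδ : -1 ≤ δ) :
    thermalFluxLogZZeeman L tp U δ β h 0 - thermalFluxLogZZeeman L tp U δ β h θ ≤
      β * (1 - Real.cos (θ / L)) *
        (ν * ((2 * ⌊(1 - δ) * (L : ℝ) ^ 2 / 2⌋₊ : ℕ) : ℝ) + 2 * ∑ k : TorusSite 2 L, ttBathtub tp ν k) := by
  have h0 := zeemanFluxZ_pos (L := L) tp U β h 0 hδ
  have hθ := zeemanFluxZ_pos (L := L) tp U β h θ hδ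
  have hge := zeemanFluxZ_ge hL tp U h θ ν hβ (δ := δ)
  have hlog := Real.log_le_log (mul_pos (Real.exp_pos _) h0) hge
  rw [Real.log_mul (Real.exp_pos _).ne' h0.ne', Real.log_exp] at hlog
  unfold thermalFluxLogZZeeman
  linarith

/-! ## §3 Thermal flux stiffness of the Zeeman ensemble ≤ the half-bathtub constant -/

/-- **Finite torus**: if `βρ_sθ² ≤ log Z_h(0) − log Z_h(θ)` on `|θ| ≤ θ₀` (`β, ρ_s, θ₀ > 0`; `L ≥ 3`, `δ ≥ −1`), then for every `ν`
`ρ_s L² ≤ νN_L/2 + Σ_k(cos k₁ + cos k₂ + 4t′cos k₁cos k₂ − ν)⁺` — the same right-hand side as the `S^z = 0` ensemble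
(`ThermalHalfBathtubStiffnessBoundTT'`), at EVERY Zeeman field. [cite: HazraVermaRanderia2019, eqs. (2)-(6)] -/
theorem zeemanStiffness_mul_sq_le [NeZero L] (hL : 3 ≤ L) (tp U h : ℝ) {δ β ρs θ₀ : ℝ} (hδ : -1 ≤ δ) (hβ : 0 < β)
    (hρs : 0 < ρs) (hθ₀ : 0 < θ₀)
    (hst : ∀ θ : ℝ, |θ| ≤ θ₀ → β * ρs * θ ^ 2 ≤
      thermalFluxLogZZeeman L tp U δ β h 0 - thermalFluxLogZZeeman L tp U δ β h θ) (ν : ℝ) :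
    ρs * (L : ℝ) ^ 2 ≤
      ν * ((2 * ⌊(1 - δ) * (L : ℝ) ^ 2 / 2⌋₊ : ℕ) : ℝ) / 2 + ∑ k : TorusSite 2 L, ttBathtub tp ν k := by
  set R := ν * ((2 * ⌊(1 - δ) * (L : ℝ) ^ 2 / 2⌋₊ : ℕ) : ℝ) / 2 + ∑ k : TorusSite 2 L, ttBathtub tp ν k with hR
  have hL0 : (0 : ℝ) < L := Nat.cast_pos.2 (NeZero.pos L)
  have hE := hst θ₀ (by rw [abs_of_pos hθ₀])
  have hD := thermalFluxLogZZeeman_sub_le hL tp U h θ₀ ν hβ.le hδ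
  have h1 : β * (ρs * θ₀ ^ 2) ≤ β * ((1 - Real.cos (θ₀ / L)) * (2 * R)) := by
    rw [hR]; nlinarith
  have h2 : ρs * θ₀ ^ 2 ≤ (1 - Real.cos (θ₀ / L)) * (2 * R) := le_of_mul_le_mul_left h1 hβ
  have hc : 0 ≤ 1 - Real.cos (θ₀ / L) := sub_nonneg.2 (Real.cos_le_one _)
  have hθ2 : 0 < θ₀ ^ 2 := by positivity
  have hRpos : 0 ≤ 2 * R := by
    by_contra hneg
    have hneg' : 2 * R < 0 := lt_of_not_ge hneg
    have : (1 - Real.cos (θ₀ / L)) * (2 * R) ≤ 0 := mul_nonpos_of_nonneg_of_nonpos hc hneg'.le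
    nlinarith
  have hstep : 2 * (1 - Real.cos (θ₀ / L)) * (2 * R) ≤ (θ₀ / L) ^ 2 * (2 * R) :=
    two_mul_one_sub_cos_mul_le _ _ hRpos
  have h3 : 2 * (ρs * θ₀ ^ 2) ≤ θ₀ ^ 2 / (L : ℝ) ^ 2 * (2 * R) := by
    have := hstep; rw [div_pow] at this; nlinarith
  rw [div_mul_eq_mul_div, le_div_iff₀ (by positivity)] at h3
  nlinarith

/-- **Thermodynamic-limit form with pub-hubbard's explicit rate** (`L ≥ 3`, `−1 ≤ δ ≤ 1`, every `t′`, `U`, `h`, `β > 0`): a thermal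
flux stiffness of the Zeeman ensemble satisfies, for every `ν`,
`ρ_s ≤ ν(1−δ)/2 + (4π²)⁻¹∫_{−π}^{π}∫_{−π}^{π}(cos x + cos y + 4t′cos x cos y − ν)⁺ dx dy + (|ν| + 2π(1 + 4|t′|))/L`
(`halfBathtubRHS_le`). [cite: HazraVermaRanderia2019, eqs. (2)-(6)] -/
theorem zeemanStiffness_le_halfBathtub [NeZero L] (hL : 3 ≤ L) (tp U h : ℝ) {δ β ρs θ₀ : ℝ} (hδ : -1 ≤ δ) (hδ1 : δ ≤ 1)
    (hβ : 0 < β) (hρs : 0 < ρs) (hθ₀ : 0 < θ₀)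
    (hst : ∀ θ : ℝ, |θ| ≤ θ₀ → β * ρs * θ ^ 2 ≤
      thermalFluxLogZZeeman L tp U δ β h 0 - thermalFluxLogZZeeman L tp U δ β h θ) (ν : ℝ) :
    ρs ≤ ν * (1 - δ) / 2 +
      (∫ y in (-π)..π, ∫ x in (-π)..π,
          max (Real.cos x + Real.cos y + 4 * tp * (Real.cos x * Real.cos y) - ν) 0) / (4 * π ^ 2) +
        (|ν| + 2 * π * (1 + 4 * |tp|)) / L := by
  have hfin := zeemanStiffness_mul_sq_le hL tp U h hδ hβ hρs hθ₀ hst ν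
  have hrhs := halfBathtubRHS_le L tp ν δ hδ1
  have hL2 : (0 : ℝ) < (L : ℝ) ^ 2 := by
    have : (0 : ℝ) < L := by exact_mod_cast (show 0 < L by omega)
    positivity
  have h := hfin.trans hrhs
  rw [mul_comm] at h
  exact le_of_mul_le_mul_left h hL2

end Summit.Ventures.CertifiedManyBodySolver.Observables

end
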